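import Summits.QuantumFields.BalabanUV.Beta.D1BFx.SortedTraces
import Summits.QuantumFields.BalabanUV.Beta.D1BFx.SortedEmbedding
import Summits.QuantumFields.BalabanUV.Beta.D1BFx.RWeightedLegPackSymm

/-!
# `BalabanUV.Beta.D1BFx.KLimitGluon` — road «BF-x» for binder row D1, slot (K), `K-ASSEMBLY-SPEC-v2.md` §4 brick **TB5-2a: THE N-SIDE (GLUON) LIMIT
# OF ROUTE T** — the `p → ∞` limit of the RIGHT side of TB5-1 `KTransferTorus.hessT_transfer_road`: for ANY bilocalised ℤ⁴ table families
# `𝒱`, `𝒲` (the N-side jets, TB4's arrays) and coarse periods `p k → ∞`,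
#   `hessT (blocksHat (p k) (sortK (m+1) (NlegRoad m a)); blocksHat (p k) (sortK (m+1) (arr ((m+1)·p k) (𝒱 μ 0))), …) ⟶ hessKer (NlegRoad m a) 𝒱 𝒲 μ ν z`
# — gan24-leaf-03-g44's TB5 SOCKET `SortedTraces.tendsto_hessT_sortK_hessKer` fed with the N-leg's four sockets (ne9-leaf-06 `RWeightedLegPack[Symm]`:
# `spr_NlegRoad`, `shiftK_NlegRoad`, `NlegRoad_inr_row_off`, `NlegRoad_inr_col_off`), in TB1∕TB5-1's `blocksHat` currency

HONEST FRAMING (cell contract, verbatim): «discharging `BetaPertH` makes Bałaban's UV stability UNCONDITIONAL — a real constructive-QFT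
result; it is NOT the continuum limit and NOT the Clay problem.»  HONEST DEPENDENCY (verbatim): «continuum YM on T⁴ ⇐ BetaPertH ∧ nine
spine estimates (0/9 proved); BetaPertH ⇐ (D1) ∧ (D4) ∧ CAP+tail; G-an2-4 gates asym, D1 and NE2/3/4.»  THIS MODULE DISCHARGES NOTHING of
D1 / BetaPertH: [folklore] compositions BY NAME (`SortedTraces`, `SortedEmbedding.hessT_reindex`, `SortedKernels.blocksHat_eq_reindex`,
`SortedRelInv.spr_decays_pos`, `RWeightedLegPack[Symm]`).  No `def`, no `def … : Prop`, nothing cited, 0 sorry.  DISPLAYED: the decay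
`Spr (Ga (m+1) a)` (printed [B5, Prop. 1.2] ∧ [(1.126)–(1.127)], `GluonLegTails.spr_Ga_of_prop12`) and the bilocalisation of the table families
(TB4's sockets).  NOT summit progress; NOT BetaPertH, NOT continuum, NOT Clay.

ABSOLUTE RULE (cell, verbatim): «No internally-minted statement may enter as a cited fact. Every hypothesis is either kernel-proved in this
package or a verbatim quotation of a PUBLISHED theorem with page reference. The manuscript(s) under audit are NOT citable for their own
disputed steps — they are the thing under adjudication; programme-internal (2001/route/tribunal) claims are never citable.»

CONTENT (all [folklore]).
* §1 `hessT_blocksHat_sortK` — `hessT` over the four `blocksHat p (sortK n ·)` = `hessT` over the four `(periodiseF p (sortK n ·))^` (re-indexing).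
* §2 **`tendsto_hessT_blocksHat_sortK`** — the TB5 socket in `blocksHat` currency, for ANY spread block-covariant lattice-supported leg pack `A`.
* §3 **`tendsto_hessT_NlegRoad`** — the N-side limit of route T (leg `NlegRoad m a`, modulo `Spr (Ga (m+1) a)`).
Unit `b2b-balaban-beta-d1-p2` (road owner, gen 6).
-/

noncomputable section

namespace Summit.QuantumFields.BalabanUV.Beta.D1BFx.KLimitGluon

open Matrix Filter Topology
open scoped BigOperators
open Literature.Probability.LatticeModels (TorusSite Torus.proj)
open Literature.MathematicalPhysics.QuantumFieldTheory.Balaban1983to89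
open Literature.MathematicalPhysics.QuantumFieldTheory.Balaban1983to89.Beta
open ExpKernelCalculus (MKer Decays BiLoc hessKer shiftK)
open OneStepResolventKernel (Fib)
open Summit.QuantumFields.BalabanUV.Beta.TameKernelCalculus (Spr)
open Summit.QuantumFields.BalabanUV.Beta.D1BFx.FibredPeriodisation (periodiseF)
open Summit.QuantumFields.BalabanUV.Beta.D1BFx.SortedKernels (blocksHat blocksHat_eq_reindex)
open Summit.QuantumFields.BalabanUV.Beta.D1BFx.SortedPack (sortK)
open Summit.QuantumFields.BalabanUV.Beta.D1BFx.SortedRelInv (spr_decays_pos)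
open Summit.QuantumFields.BalabanUV.Beta.D1BFx.SortedEmbedding (hessT_reindex)
open Summit.QuantumFields.BalabanUV.Beta.D1BFx.SortedTraces (tendsto_hessT_sortK_hessKer)
open Summit.QuantumFields.BalabanUV.Beta.D1BFx.PeriodicArrays (arr)
open Summit.QuantumFields.BalabanUV.Beta.D1BFx.MixedVarPackedHess (hessT)
open Summit.QuantumFields.BalabanUV.Beta.D1BFx.RWeightedLegPack (NlegRoad spr_NlegRoad NlegRoad_inr_row_off NlegRoad_inr_col_off shiftK_NlegRoad)

/-! ## §1 `hessT` in the `blocksHat` currency is `hessT` in the sorted-periodisation currency -/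

section Reindex

variable {D : ℕ} {F : Type*} [Fintype F] {n : ℕ} [NeZero n] (p : ℕ) [NeZero p]

/-- [folklore] `hessT` over `blocksHat p (sortK n ·)` equals `hessT` over `(periodiseF p (sortK n ·))^` (`blocksHat = reindex ∘ of ∘ periodiseF`,
`hessT_reindex`). -/
theorem hessT_blocksHat_sortK (L V V' W : MKer D (F ⊕ F)) :
    hessT (blocksHat p (sortK n L)) (blocksHat p (sortK n V)) (blocksHat p (sortK n V')) (blocksHat p (sortK n W))
      = hessT (Matrix.of (periodiseF p (sortK n L))) (Matrix.of (periodiseF p (sortK n V))) (Matrix.of (periodiseF p (sortK n V')))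
          (Matrix.of (periodiseF p (sortK n W))) := by
  rw [blocksHat_eq_reindex, blocksHat_eq_reindex, blocksHat_eq_reindex, blocksHat_eq_reindex, hessT_reindex]

end Reindex

/-! ## §2 The TB5 socket in `blocksHat` currency -/

section Socket

variable {D : ℕ} {F : Type*} [Fintype F] {n : ℕ} [NeZero n]

/-- [folklore] **THE TB5 SOCKET IN `blocksHat` CURRENCY** (`SortedTraces.tendsto_hessT_sortK_hessKer` re-indexed): for a leg pack `A` that is
decaying, block covariant and lattice supported in its multiplier rows∕columns, and bilocalised table families `𝒱`, `𝒲`,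
`hessT (blocksHat (p k) (sortK n A); blocksHat (p k) (sortK n (arr (n·p k) ·))) ⟶ hessKer A 𝒱 𝒲 μ ν z` as `p k → ∞`. -/
theorem tendsto_hessT_blocksHat_sortK {A : MKer D (F ⊕ F)} {CA δA : ℝ} (hA : Decays A CA δA) (hδA : 0 < δA)
    (hAcov : ∀ t : Fin D → ℤ, shiftK ((n : ℤ) • t) A = A)
    (hAr : ∀ x y f b, Torus.proj n x ≠ 0 → A x y (Sum.inr f) b = 0) (hAc : ∀ x y a f, Torus.proj n y ≠ 0 → A x y a (Sum.inr f) = 0)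
    (𝒱 : Fin D → (Fin D → ℤ) → MKer D (F ⊕ F)) (𝒲 : Fin D → (Fin D → ℤ) → Fin D → (Fin D → ℤ) → MKer D (F ⊕ F))
    (μ ν : Fin D) (z : Fin D → ℤ) {P P' Q Q' : Fin D → ℤ} {Cv Cv' C δ : ℝ}
    (hV : BiLoc (𝒱 μ 0) P P' Cv δ) (hV' : BiLoc (𝒱 ν z) Q' Q Cv' δ) (hW : BiLoc (𝒲 μ 0 ν z) P Q C δ) (hδ : 0 < δ)
    {p : ℕ → ℕ} [∀ k, NeZero (p k)] (hp : Tendsto p atTop atTop) :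
    Tendsto (fun k => hessT (blocksHat (p k) (sortK n A))
        (blocksHat (p k) (sortK n (arr (n * p k) (𝒱 μ 0))))
        (blocksHat (p k) (sortK n (arr (n * p k) (𝒱 ν z))))
        (blocksHat (p k) (sortK n (arr (n * p k) (𝒲 μ 0 ν z)))))
      atTop (𝓝 (hessKer A 𝒱 𝒲 μ ν z)) := by
  simp only [hessT_blocksHat_sortK]
  exact tendsto_hessT_sortK_hessKer hA hδA hAcov hAr hAc 𝒱 𝒲 μ ν z hV hV' hW hδ hp

end Socket

/-! ## §3 The N-side (gluon) limit of route T -/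

/-- [folklore] **TB5-2a: THE N-SIDE LIMIT OF ROUTE T.**  For the road's R-weighted leg pack `NlegRoad m a` (spread modulo `Spr (Ga (m+1) a)`,
block covariant, lattice supported) and ANY bilocalised table families `𝒱`, `𝒲`:
`hessT (blocksHat (p k) (sortK (m+1) (NlegRoad m a)); blocksHat (p k) (sortK (m+1) (arr ((m+1)·p k) ·))) ⟶ hessKer (NlegRoad m a) 𝒱 𝒲 μ ν z`. -/
theorem tendsto_hessT_NlegRoad (m : ℕ) {a : ℝ} (hGa : Spr (GluonLeg.Ga (m + 1) a))
    (𝒱 : Fin 4 → (Fin 4 → ℤ) → MKer 4 (Fib 3)) (𝒲 : Fin 4 → (Fin 4 → ℤ) → Fin 4 → (Fin 4 → ℤ) → MKer 4 (Fib 3))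
    (μ ν : Fin 4) (z : Fin 4 → ℤ) {P P' Q Q' : Fin 4 → ℤ} {Cv Cv' C δ : ℝ}
    (hV : BiLoc (𝒱 μ 0) P P' Cv δ) (hV' : BiLoc (𝒱 ν z) Q' Q Cv' δ) (hW : BiLoc (𝒲 μ 0 ν z) P Q C δ) (hδ : 0 < δ)
    {p : ℕ → ℕ} [∀ k, NeZero (p k)] (hp : Tendsto p atTop atTop) :
    Tendsto (fun k => hessT (blocksHat (p k) (sortK (m + 1) (NlegRoad m a)))
        (blocksHat (p k) (sortK (m + 1) (arr ((m + 1) * p k) (𝒱 μ 0))))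
        (blocksHat (p k) (sortK (m + 1) (arr ((m + 1) * p k) (𝒱 ν z))))
        (blocksHat (p k) (sortK (m + 1) (arr ((m + 1) * p k) (𝒲 μ 0 ν z)))))
      atTop (𝓝 (hessKer (NlegRoad m a) 𝒱 𝒲 μ ν z)) := by
  obtain ⟨CA, δA, hδA, -, hdec⟩ := spr_decays_pos (spr_NlegRoad m a hGa)
  exact tendsto_hessT_blocksHat_sortK hdec hδA (shiftK_NlegRoad m a)
    (fun x y f b hx => NlegRoad_inr_row_off m a hx y f b) (fun x y a₀ f hy => NlegRoad_inr_col_off m a x hy a₀ f)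
    𝒱 𝒲 μ ν z hV hV' hW hδ hp

end Summit.QuantumFields.BalabanUV.Beta.D1BFx.KLimitGluon

end
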